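import Mathlib
import HarnessLib
import Summits.HubbardSuperconductivity.HubbardSuperconductivity.Theorems.KLProgrammeKLRegimeEngineTowerRemeasureLev
import Summits.HubbardSuperconductivity.HubbardSuperconductivity.Theorems.KLProgrammeKLRegimeEngineTowerBlockIncrLevKit

/-!
# Route `KLProgramme` — crux K3 ENGINE (stmt-HubbardSuperconductivity-20437 `KLRegimeEngineV17F2`), stub (b) v2, THE LEVELS PACKAGE (ℓ), instantiation (I2):
# THE LEVELLED ARRAYS ARE ANTITONE IN THE LEVEL COUNT — prescribing more legs only drops tuples
# (located item «(I2)-KIT-HMU-LEV», UNITS-MAP §(1)/(2): every level `F ≥ 5` is dominated into the top track; cell gate-hubbard-kl, seat p4 g17)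

E1's levelled carriers `klLevNormOf … J m T Ωe` (`…EngineTowerModelDefs`) are sectorised `L¹–L^∞` norms over `prescribedTuples (bgmSectorSet …) Ωe`; a FINER
prescription `Ωe` (every label prescribed by `Ωe′` is prescribed by `Ωe`) keeps fewer tuples, so the norm can only drop (`prescribedTuples_mono`,
`sectorisedKernelNorm_mono_set`).  Taking suprema: the measured / born levelled arrays `klTowerMeasLev/BornLev … m F` are ANTITONE in `F ≤ m`
(every prescription of level `F` coarsens to one of any smaller level `F′`, `Finset.exists_subset_card_eq`).  This is the one monotonicity row the kit's
`hμ` instantiation uses to fold the levels `F ≥ 5` (all with the same units `e* = 2`) into the top track (UNITS-MAP §(2), last line).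

* `klLevNormOf_anti` — `klLevNormOf … Ωe ≤ klLevNormOf … Ωe′` for `Ωe` finer than `Ωe′`;
* `exists_coarsening_of_levelCount` — a prescription of level `F` has a coarsening of every level `F′ ≤ F`;
* **`klTowerMeasLev_anti`**, **`klTowerBornLev_anti`** — `F′ ≤ F ≤ m ⇒ (array at F) ≤ (array at F′)`.
Everything is proved; no definitions; nothing about the model is asserted; nothing asserts superconductivity.
References: BGM 2006 §2.8 (2.73), (2.76) [cite: BenfattoGiulianiMastropietro2006].
-/

noncomputable section

namespace Summit.HubbardSuperconductivity.HubbardSuperconductivity.Theorems.EngineV8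

set_option linter.dupNamespace false -- summit = problem name (single-conjunct summit), D-0017

open Classical
open Real Finset Literature.MathematicalPhysics.QuantumLattice Literature.Probability.LatticeModels GrassmannAlgebra
open Literature.MathematicalPhysics.QuantumLattice.FermiRG
open Summit.HubbardSuperconductivity.HubbardSuperconductivity.Theorems.KLRegimeSplit
open Summit.HubbardSuperconductivity.HubbardSuperconductivity.Theorems.KLProgrammeLegKernels
open Summit.HubbardSuperconductivity.HubbardSuperconductivity.Theorems.DispersionFlow

variable {L M : ℕ} [NeZero L] [NeZero M]

/-! ## §1 Finer prescriptions give smaller levelled norms -/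

omit [NeZero M] in
/-- **A finer prescription gives a smaller levelled norm**: if every label prescribed by `Ωe′` is prescribed (with the same value) by `Ωe`, then
`klLevNormOf … Ωe ≤ klLevNormOf … Ωe′` (`0 ≤ β`). [cite: BenfattoGiulianiMastropietro2006, §2.8 (2.73), (2.76)] -/
theorem klLevNormOf_anti {β : ℝ} (hβ : 0 ≤ β) (μ : ℝ) (K : TrigPolyC4v) (J m : ℕ) (T : HubbardGrassmann L M)
    {Ωe Ωe' : Fin m → Option (SectorLeg (sectorCount J))} (h : ∀ i, ∀ s ∈ Ωe' i, Ωe i = some s) :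
    klLevNormOf L M β μ K J m T Ωe ≤ klLevNormOf L M β μ K J m T Ωe' := by
  rw [klLevNormOf, klLevNormOf, hubbardSectorKernelNorm_def, hubbardSectorKernelNorm_def]
  exact sectorisedKernelNorm_mono_set (imagTimeWeight_nonneg hβ M) (prescribedTuples_mono _ h) _

omit [NeZero L] [NeZero M] in
/-- **Every prescription of level `F` coarsens to one of any level `F′ ≤ F`** (keep the prescribed labels on a subset of `F′` of the prescribed legs). [folklore] -/
theorem exists_coarsening_of_levelCount {m N F F' : ℕ} (hF : F' ≤ F) (Ωe : Fin m → Option (SectorLeg N)) (hΩ : levelCount Ωe = F) :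
    ∃ Ωe' : Fin m → Option (SectorLeg N), levelCount Ωe' = F' ∧ ∀ i, ∀ s ∈ Ωe' i, Ωe i = some s := by
  obtain ⟨t, ht, htcard⟩ := Finset.exists_subset_card_eq (s := univ.filter fun i : Fin m => (Ωe i).isSome) (n := F')
    (by rw [← levelCount, hΩ]; exact hF)
  refine ⟨fun i => if i ∈ t then Ωe i else none, ?_, fun i s hs => ?_⟩
  · rw [levelCount, ← htcard]
    congr 1
    ext i
    simp only [mem_filter, mem_univ, true_and]
    constructor
    · intro hi
      by_contra hit
      simp [hit] at hi
    · intro hit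
      have hsome : (Ωe i).isSome := by
        have := ht hit
        simpa using this
      simp [hit, hsome]
  · by_cases hit : i ∈ t
    · simpa [hit] using hs
    · simp [hit] at hs

/-! ## §2 The tower's levelled arrays are antitone in the level count -/

omit [NeZero M] in
/-- **The measured levelled array is antitone in the level count**: `F′ ≤ F ⇒ klTowerMeasLev … d k m F ≤ klTowerMeasLev … d k m F′` (`0 ≤ β`). -/
theorem klTowerMeasLev_anti {β : ℝ} (hβ : 0 ≤ β) (U μ : ℝ) (K : TrigPolyC4v) (d k m : ℕ) {F F' : ℕ} (hF : F' ≤ F) :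
    klTowerMeasLev L M β U μ K d k m F ≤ klTowerMeasLev L M β U μ K d k m F' := by
  have h0 := klTowerMeasLev_nonneg (L := L) (M := M) hβ U μ K d k m F'
  unfold klTowerMeasLev at h0 ⊢
  rcases isEmpty_or_nonempty {Ωe : Fin m → Option (SectorLeg (sectorCount (d * k - 1))) // levelCount Ωe = F} with h | h
  · rw [Real.iSup_of_isEmpty]; exact h0
  · refine ciSup_le fun Ωe => ?_
    obtain ⟨Ωe', hlev, hco⟩ := exists_coarsening_of_levelCount hF Ωe.1 Ωe.2
    exact (klLevNormOf_anti hβ μ K _ m _ hco).trans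
      (le_ciSup (f := fun Ωe'' : {Ωe'' : Fin m → Option (SectorLeg (sectorCount (d * k - 1))) // levelCount Ωe'' = F'} =>
        klLevNormOf L M β μ K (d * k - 1) m (klTowerInput L M β U μ K d k) Ωe''.1) (Set.finite_range _).bddAbove ⟨Ωe', hlev⟩)

omit [NeZero M] in
/-- **The born levelled array is antitone in the level count**: `F′ ≤ F ⇒ klTowerBornLev … d k m F ≤ klTowerBornLev … d k m F′` (`0 ≤ β`). -/
theorem klTowerBornLev_anti {β : ℝ} (hβ : 0 ≤ β) (U μ : ℝ) (K : TrigPolyC4v) (d k m : ℕ) {F F' : ℕ} (hF : F' ≤ F) :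
    klTowerBornLev L M β U μ K d k m F ≤ klTowerBornLev L M β U μ K d k m F' := by
  have h0 := klTowerBornLev_nonneg (L := L) (M := M) hβ U μ K d k m F'
  unfold klTowerBornLev at h0 ⊢
  rcases isEmpty_or_nonempty {Ωe : Fin m → Option (SectorLeg (sectorCount (d * k))) // levelCount Ωe = F} with h | h
  · rw [Real.iSup_of_isEmpty]; exact h0
  · refine ciSup_le fun Ωe => ?_
    obtain ⟨Ωe', hlev, hco⟩ := exists_coarsening_of_levelCount hF Ωe.1 Ωe.2
    exact (klLevNormOf_anti hβ μ K _ m _ hco).trans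
      (le_ciSup (f := fun Ωe'' : {Ωe'' : Fin m → Option (SectorLeg (sectorCount (d * k))) // levelCount Ωe'' = F'} =>
        klLevNormOf L M β μ K (d * k) m (klTowerIncr L M β U μ K d k) Ωe''.1) (Set.finite_range _).bddAbove ⟨Ωe', hlev⟩)

end Summit.HubbardSuperconductivity.HubbardSuperconductivity.Theorems.EngineV8

end
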